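/-
Copyright (c) 2026 the pub-hodgecm-mathlib formalisation cell (harness21).  Prover seat hodgecm-mathlib-LH4-p08 (g5), Track A «(D-RAM) FOUR-FRAME», unit U2H, the census leaf
(ρ2b′-X) `stub_U2H_fixedPointCensus_typeTwo_unit0` — dealer LH4-plan (g12) WORD #16∕#21∕#27 hand T5a «TORIC LEVEL CENSUS» (payer LH4-p14; plan owner LH4-p12 (g4)):
the TOP CELLS of the depth-refined census, ANISOTROPIC side, with the top bit in its EXISTENTIAL form.  2026-09-04.
-/
import Summits.HodgeConjecture.HodgeConjecture.Theorems.F0P3cDyRamToricLevelCensusUnrTopPrep   -- ★ p857519 (this lineage): approximate translation, dep-top form, bit in unit form, generator classes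
import Summits.HodgeConjecture.HodgeConjecture.Theorems.F0P3cDyRamToricLevelCensusUnrAniso     -- ★ p857464 (this lineage): (UNR-aniso) head, parity `exists_v_eq_exp_of_aniso`, constancy `v_one_add_twist_eq_of_parity`
import HarnessLib

/-!
# T5a: the TOP cells of the depth-refined level census, anisotropic side — `q^{⌊e∕2⌋}·#levelSetDep(j,a;μ) = χ·#levelSet(j,a)`

On the diagonal `j + m = jλ + a` with `e := 2a − m ≥ 1` (`j ≤ jλ`, `a ≥ 1`) and an ANISOTROPIC hermitian scalar `h` (no isotropic vector), the twist depth
`|1 + η·t(ω)| = exp(1 − d)` is the same for every unit `ω` (★ `v_one_add_twist_eq_of_parity`), so the level set `levelSet(j,a)` is EMPTY unless `a + d = j + 1`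
(then its generators are all of `ϖE^{k₀}·U_M`, `#levelSet(j,a) = |G_j| = (q+1)q^{j−1}`, ★ aniso head); the generators passing the depth condition are
`ϖE^{k₀}·ω₁·B_{s₀}` (`s₀ = j + a − m`) for ANY unit `ω₁` with `|1 + (η∕κ)t(ω₁)| ≤ exp(−s₀)` (★ prep file: approximate translation), or none; so
`#levelSetDep = [B_{s₀} : 𝒪_jˣ] = |G_j|∕q^{⌊(s₀+1−d)∕2⌋}` or `0`, and `s₀ + 1 − d = e` on this cell: the T5a sheet's (R1-TOP, ANISOTROPIC) sentence
`q^{⌊e∕2⌋}·#levelSetDep(j,a;μ) = χ·#levelSet(j,a)` with the bit `χ = [∃ Θ-fixed unit N : |(ρh∕h)(ρN∕N) + ρμ∕μ| ≤ exp(−s₀)]` EXISTENTIAL (its closed form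
`[jλ + 1 = d + m ∧ 2j + d ≤ 2jλ + 1]` is the separate (R1-TOP-SIDE) law).  Twin of ★ `ncard_levelSetDep_top_hyper` (p857538).
HONEST LABEL: HC_CM is proved only modulo the 7 printed citations (2 remaining named inputs: hLiu418 = stmt-HodgeConjecture-24832,
h413 = stmt-HodgeConjecture-24833) until rung 0 closes; (ρ2b′-X) :418 is an OPEN prover target — this file is a helper (`--supports`), proofs only.
-/

set_option autoImplicit false

open WithZero IsLocalRing
open scoped Valued Pointwise

namespace Summit.HodgeConjecture.HodgeConjecture.Cruxes.H413.F0P3cDyRamToricLevelCensusUnr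

open Summit.HodgeConjecture.HodgeConjecture.Cruxes.H413.F0P3cDyRamToricCensusDefs
open Literature.NumberTheory.LocalFields.QuadraticOrder Literature.NumberTheory.LocalFields.WildQuadraticDatum

variable {K : Type*} [Field K] [Valued K ℤᵐ⁰] {ρ Θ : K →+* K} {α ϖE h : K} {d q : ℕ}
variable {K' : Type*} [Field K'] [Valued K' ℤᵐ⁰] {σ' : K' →+* K'} {π' : K'}

/-! ## §5 (R1-TOP, ANISOTROPIC) -/

open scoped Classical in
/-- **(R1-TOP, ANISOTROPIC) — THE TOP CELLS OF THE ANISOTROPIC SIDE.**  On the diagonal `j + m = jλ + a` with `e = 2a − m ≥ 1` (`j ≤ jλ`, `a ≥ 1`), for an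
ANISOTROPIC hermitian scalar `h`: `q^{⌊e∕2⌋} · #levelSetDep(j,a;μ) = χ · #levelSet(j,a)` with the bit `χ = [∃ Θ-fixed unit N : |(ρh∕h)(ρN∕N) + ρμ∕μ| ≤ exp(−(j + a − m))]`
(the level set lives only at `a + d = j + 1`, where its generators are all of `ϖE^{k₀}·U_M`; the passing ones are `ϖE^{k₀}·ω₁·B_{j+a−m}` for any solution `ω₁`,
counted by `[B_{j+a−m} : 𝒪_jˣ] = (q+1)q^{j−1}∕q^{⌊(j+a−m+1−d)∕2⌋}` and `j + a − m + 1 − d = e` there).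
[cite: Jacobowitz1962, §4] [cite: Serre1979, Ch. V §3] [cite: Flicker1998UnitaryFL, p. 84] -/
theorem ncard_levelSetDep_top_aniso
    (hρρ : ∀ x, ρ (ρ x) = x) (hvρ : ∀ x, Valued.v (ρ x) = Valued.v x) (hΘΘ : ∀ x, Θ (Θ x) = x) (hΘρ : ∀ x, Θ (ρ x) = ρ (Θ x))
    (hvΘ : ∀ x, Valued.v (Θ x) = Valued.v x) (hα1 : Valued.v α ≤ 1) (hα : Valued.v (α - ρ α) = 1)
    (hρϖE : ρ ϖE = ϖE) (hϖE : Valued.v ϖE = exp (-1 : ℤ)) (hΘh : Θ h = h) (hh : h ≠ 0)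
    [IsDiscreteValuationRing 𝒪[K]] [Finite 𝓀[K]] (hq : Nat.card 𝓀[K] = q ^ 2)
    (hσ' : ∀ x, σ' (σ' x) = x) (hvσ' : ∀ x, Valued.v (σ' x) = Valued.v x) (hfix' : ∀ x : K', σ' x = x → x ≠ 0 → ∃ n : ℤ, Valued.v x = exp (2 * n))
    (hπ' : Valued.v π' = exp (-1 : ℤ)) (hdd' : Valued.v (π' - σ' π') = Valued.v π' ^ d) (hd : 1 ≤ d) [IsDiscreteValuationRing 𝒪[K']] [Finite 𝓀[K']]
    (hq' : Nat.card 𝓀[K'] = q) (jK : K' →+* K) (hjv : ∀ x, Valued.v (jK x) = Valued.v x) (hjΘ : ∀ x, Θ (jK x) = jK x)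
    (hjfix : ∀ z : K, Θ z = z → ∃ x, jK x = z) (hjσ : ∀ x, jK (σ' x) = ρ (jK x))
    (hnorm : ∀ z : Kˣ, Θ (z : K) = z → Valued.v (z : K) = 1 → ∃ ω : Kˣ, Valued.v (ω : K) = 1 ∧ (ω : K) * Θ ω = z)
    (haniso : ¬ ∃ x : K, x ≠ 0 ∧ h * Θ x * x + ρ (h * Θ x * x) = 0)
    {μ : K} {m jl : ℕ} (hm : Valued.v μ = exp (-(m : ℤ))) (hjl : Valued.v (μ - ρ μ) = exp (-(jl : ℤ)))
    {j a : ℕ} (hj : j ≤ jl) (ha : 1 ≤ a) (hdiag : j + m = jl + a) (htop : m + 1 ≤ 2 * a) :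
    q ^ ((2 * a - m) / 2) * (levelSetDep ρ Θ α ϖE h j a μ).ncard =
      if ∃ N : K, Θ N = N ∧ Valued.v N = 1 ∧ Valued.v (ρ h / h * (ρ N / N) + ρ μ / μ) ≤ exp (-((j + a : ℕ) - (m : ℤ)))
      then (levelSet ρ Θ α ϖE h j a).ncard else 0 := by
  classical
  have hϖ0 : ϖE ≠ 0 := (v_varpi_zpow hϖE 0).1
  have hμ0 : μ ≠ 0 := fun h0 => by rw [h0, map_zero] at hm; exact (exp_ne_zero hm.symm).elim
  have hκ : Valued.v (ρ μ / μ) = 1 := by rw [map_div₀, hvρ, div_self ((Valuation.ne_zero_iff _).2 hμ0)]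
  have ham : a ≤ m := by omega
  -- (0) the PARITY `|h| = exp(2n + 1 − d)` of an anisotropic scalar and the CONSTANCY of the twist depth on units
  obtain ⟨n, hvh⟩ := exists_v_eq_exp_of_aniso hΘh hh hσ' hvσ' hπ' hdd' jK hjv hjΘ hjfix hjσ hnorm haniso
  have hvh' : Valued.v h = exp (-((d : ℤ) - 2 * n - 1)) := by rw [hvh]; congr 1; ring
  have hconst := v_one_add_twist_eq_of_parity hΘΘ hvΘ hΘh hh hσ' hvσ' hfix' hπ' hdd' hd jK hjv hjfix hjσ hvh
  -- (1) order units `H = 𝒪_jˣ`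
  obtain ⟨U, hU⟩ := exists_subgroup_v_eq_one (K := K)
  obtain ⟨H, hH⟩ := exists_subgroup_orderUnits (ρ := ρ) (α := α) hvρ (ϖE ^ j)
  have hvc : Valued.v (ϖE ^ j * (α - ρ α)) = exp (-(j : ℤ)) := by
    rw [map_mul, hα, mul_one, map_pow, hϖE, ← exp_nsmul, nsmul_eq_mul, mul_neg, mul_one]
  -- (2) the `levelSetDep` side as generator classes
  rw [ncard_levelSetDep_eq_ncard_image_mk hρρ hvρ hΘΘ hΘρ hvΘ hα1 hα hρϖE hϖE hh hm j a hH]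
  by_cases hgood : a + d = j + 1
  swap
  · -- EMPTY LEVEL SET: no generator at all (constancy of the twist depth off `a + d = j + 1`, or the parity fails)
    have hP : {x₀ : Kˣ |
        ((Valued.v (h * ((x₀ : K) * Θ x₀) * (ϖE ^ j * (α - ρ α))) ≤ 1 ∧
              Valued.v (h * ((x₀ : K) * Θ x₀) * (ϖE ^ j * (α - ρ α)) - ρ (h * ((x₀ : K) * Θ x₀) * (ϖE ^ j * (α - ρ α)))) ≤ Valued.v (ϖE ^ j * (α - ρ α))) ∧
            ¬ (Valued.v (h * ((x₀ : K) * Θ x₀) * (ϖE ^ j * (α - ρ α)) / ϖE) ≤ 1 ∧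
                Valued.v (h * ((x₀ : K) * Θ x₀) * (ϖE ^ j * (α - ρ α)) / ϖE - ρ (h * ((x₀ : K) * Θ x₀) * (ϖE ^ j * (α - ρ α)) / ϖE)) ≤
                  Valued.v (ϖE ^ j * (α - ρ α)))) ∧
          Valued.v (h * ((x₀ : K) * Θ x₀) * (ϖE ^ j * (α - ρ α))) = exp (-(a : ℤ))} = ∅ := by
      by_cases hpar : (j + a + d) % 2 = 1
      · -- solvable parity, `a + d ≠ j + 1`: the exact-depth set `{|1 + ηt| = exp(a − j)}` of units is empty (every unit sits at depth `d − 1`)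
        rw [setOf_levelGen_eq_smul_of_pos hρρ hΘρ hvΘ hα hϖE hρϖE hϖ0 hh hvh' j ha (k₀ := n + ((a : ℤ) - j - d + 1) / 2) (by omega)]
        have hS : {ω : Kˣ | Valued.v (ω : K) = 1 ∧ Valued.v (1 + ρ h / h * (ρ ((ω : K) * Θ ω) / ((ω : K) * Θ ω))) = exp ((a : ℤ) - j)} = ∅ := by
          ext ω
          simp only [Set.mem_setOf_eq, Set.mem_empty_iff_false, iff_false, not_and]
          intro h1
          rw [hconst ω h1, exp_inj]; omega
        rw [hS, Set.smul_set_empty]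
      · exact setOf_levelGen_eq_empty_of_odd hvΘ hα hϖE hvh' j a (fun k hk => by omega)
    have hPQ :
      {x₀ : Kˣ |
        (((Valued.v (h * ((x₀ : K) * Θ x₀) * (ϖE ^ j * (α - ρ α))) ≤ 1 ∧
              Valued.v (h * ((x₀ : K) * Θ x₀) * (ϖE ^ j * (α - ρ α)) - ρ (h * ((x₀ : K) * Θ x₀) * (ϖE ^ j * (α - ρ α)))) ≤ Valued.v (ϖE ^ j * (α - ρ α))) ∧
            ¬ (Valued.v (h * ((x₀ : K) * Θ x₀) * (ϖE ^ j * (α - ρ α)) / ϖE) ≤ 1 ∧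
                Valued.v (h * ((x₀ : K) * Θ x₀) * (ϖE ^ j * (α - ρ α)) / ϖE - ρ (h * ((x₀ : K) * Θ x₀) * (ϖE ^ j * (α - ρ α)) / ϖE)) ≤
                  Valued.v (ϖE ^ j * (α - ρ α)))) ∧
          Valued.v (h * ((x₀ : K) * Θ x₀) * (ϖE ^ j * (α - ρ α))) = exp (-(a : ℤ))) ∧
        (a ≤ m ∧ (j + a ≤ m ∨
          Valued.v (μ / (h * ((x₀ : K) * Θ x₀) * (ϖE ^ j * (α - ρ α)) * ϖE ^ (m - a)) -
              ρ (μ / (h * ((x₀ : K) * Θ x₀) * (ϖE ^ j * (α - ρ α)) * ϖE ^ (m - a)))) ≤ exp (-((j + a : ℕ) - (m : ℤ)))))} = ∅ :=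
      Set.eq_empty_of_forall_notMem (fun x₀ hx => (Set.ext_iff.1 hP x₀).1 hx.1)
    rw [hPQ, Set.image_empty, Set.ncard_empty, mul_zero]
    split_ifs with h0
    · rw [ncard_levelSet_unr_aniso hρρ hvρ hΘΘ hΘρ hvΘ hα1 hα hρϖE hϖE hΘh hh hq hσ' hvσ' hfix' hπ' hdd' hd jK hjv hjΘ hjfix hjσ hnorm haniso j a,
        if_neg (show ¬((d ≤ j + 1 ∧ a + d = j + 1) ∨ (j + 1 < d ∧ a = 0 ∧ (j + d) % 2 = 1)) by omega)]
    · rfl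
  -- MAIN CASE: `a + d = j + 1` (so `j ≥ d ≥ 1`); every unit generates a level-`a` member
  have hma : m < j + a := by omega
  have he : m < 2 * a := by omega
  set g : Kˣ := Units.mk0 ϖE hϖ0 ^ (n + 1 - (d : ℤ)) with hg
  have hGen := setOf_levelGen_eq_smul_of_pos hρρ hΘρ hvΘ hα hϖE hρϖE hϖ0 hh hvh' j ha (k₀ := n + 1 - (d : ℤ)) (by omega)
  have hgcoe : ∀ ω : Kˣ, ((g • ω : Kˣ) : K) = ϖE ^ (n + 1 - (d : ℤ)) * ω := fun ω => by
    rw [smul_eq_mul, Units.val_mul, hg, Units.val_zpow_eq_zpow_val, Units.val_mk0]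
  -- the passing generators: `g • {ω ∈ U_M : |1 + (η∕κ) t(ω)| ≤ exp(−s₀)}`
  have hPQ : {x₀ : Kˣ |
        (((Valued.v (h * ((x₀ : K) * Θ x₀) * (ϖE ^ j * (α - ρ α))) ≤ 1 ∧
              Valued.v (h * ((x₀ : K) * Θ x₀) * (ϖE ^ j * (α - ρ α)) - ρ (h * ((x₀ : K) * Θ x₀) * (ϖE ^ j * (α - ρ α)))) ≤ Valued.v (ϖE ^ j * (α - ρ α))) ∧
            ¬ (Valued.v (h * ((x₀ : K) * Θ x₀) * (ϖE ^ j * (α - ρ α)) / ϖE) ≤ 1 ∧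
                Valued.v (h * ((x₀ : K) * Θ x₀) * (ϖE ^ j * (α - ρ α)) / ϖE - ρ (h * ((x₀ : K) * Θ x₀) * (ϖE ^ j * (α - ρ α)) / ϖE)) ≤
                  Valued.v (ϖE ^ j * (α - ρ α)))) ∧
          Valued.v (h * ((x₀ : K) * Θ x₀) * (ϖE ^ j * (α - ρ α))) = exp (-(a : ℤ))) ∧
        (a ≤ m ∧ (j + a ≤ m ∨
          Valued.v (μ / (h * ((x₀ : K) * Θ x₀) * (ϖE ^ j * (α - ρ α)) * ϖE ^ (m - a)) -
              ρ (μ / (h * ((x₀ : K) * Θ x₀) * (ϖE ^ j * (α - ρ α)) * ϖE ^ (m - a)))) ≤ exp (-((j + a : ℕ) - (m : ℤ)))))} =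
      g • {ω : Kˣ | Valued.v (ω : K) = 1 ∧
        Valued.v (1 + ρ h / h / (ρ μ / μ) * (ρ ((ω : K) * Θ ω) / ((ω : K) * Θ ω))) ≤ exp (-((j + a : ℕ) - (m : ℤ)))} := by
    ext x₀
    rw [Set.mem_smul_set_iff_inv_smul_mem, Set.mem_setOf_eq, Set.mem_setOf_eq]
    have hx : x₀ = g • (g⁻¹ • x₀) := (smul_inv_smul g x₀).symm
    have hxcoe : (x₀ : K) = ϖE ^ (n + 1 - (d : ℤ)) * ((g⁻¹ • x₀ : Kˣ) : K) := by
      conv_lhs => rw [hx]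
      exact hgcoe _
    have htw : ρ ((x₀ : K) * Θ x₀) / ((x₀ : K) * Θ x₀) =
        ρ (((g⁻¹ • x₀ : Kˣ) : K) * Θ ((g⁻¹ • x₀ : Kˣ) : K)) / (((g⁻¹ • x₀ : Kˣ) : K) * Θ ((g⁻¹ • x₀ : Kˣ) : K)) := by
      rw [hxcoe]; exact twist_varpi_zpow_mul hΘρ hρϖE hϖ0 _ _
    constructor
    · rintro ⟨hP, hQ⟩
      have hmem : x₀ ∈ g • {ω : Kˣ | Valued.v (ω : K) = 1 ∧
          Valued.v (1 + ρ h / h * (ρ ((ω : K) * Θ ω) / ((ω : K) * Θ ω))) = exp ((a : ℤ) - j)} := by rw [← hGen]; exact hP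
      rw [Set.mem_smul_set_iff_inv_smul_mem, Set.mem_setOf_eq] at hmem
      refine ⟨hmem.1, ?_⟩
      have hya : Valued.v (h * ((x₀ : K) * Θ x₀) * (ϖE ^ j * (α - ρ α))) = Valued.v ϖE ^ a := by rw [hP.2, v_pow_eq_exp_neg hϖE]
      have hQ' := (dep_top_iff (Θ := Θ) (α := α) hρρ hvρ hρϖE hϖE hh hm hjl ham hma x₀.ne_zero ((map_ne_zero Θ).2 x₀.ne_zero) hya).1 hQ
      rw [htw] at hQ'; exact hQ'
    · rintro ⟨hω1, hωtop⟩
      have hlevel : Valued.v (1 + ρ h / h * (ρ (((g⁻¹ • x₀ : Kˣ) : K) * Θ ((g⁻¹ • x₀ : Kˣ) : K)) /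
          (((g⁻¹ • x₀ : Kˣ) : K) * Θ ((g⁻¹ • x₀ : Kˣ) : K)))) = exp ((a : ℤ) - j) :=
        v_one_add_twist_eq_of_top hvρ hm hjl hdiag he hωtop
      have hP : x₀ ∈ {x₀ : Kˣ |
          ((Valued.v (h * ((x₀ : K) * Θ x₀) * (ϖE ^ j * (α - ρ α))) ≤ 1 ∧
                Valued.v (h * ((x₀ : K) * Θ x₀) * (ϖE ^ j * (α - ρ α)) - ρ (h * ((x₀ : K) * Θ x₀) * (ϖE ^ j * (α - ρ α)))) ≤ Valued.v (ϖE ^ j * (α - ρ α))) ∧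
              ¬ (Valued.v (h * ((x₀ : K) * Θ x₀) * (ϖE ^ j * (α - ρ α)) / ϖE) ≤ 1 ∧
                  Valued.v (h * ((x₀ : K) * Θ x₀) * (ϖE ^ j * (α - ρ α)) / ϖE - ρ (h * ((x₀ : K) * Θ x₀) * (ϖE ^ j * (α - ρ α)) / ϖE)) ≤
                    Valued.v (ϖE ^ j * (α - ρ α)))) ∧
            Valued.v (h * ((x₀ : K) * Θ x₀) * (ϖE ^ j * (α - ρ α))) = exp (-(a : ℤ))} := by
        rw [hGen, Set.mem_smul_set_iff_inv_smul_mem, Set.mem_setOf_eq]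
        exact ⟨hω1, hlevel⟩
      rw [Set.mem_setOf_eq] at hP
      refine ⟨hP, ?_⟩
      have hya : Valued.v (h * ((x₀ : K) * Θ x₀) * (ϖE ^ j * (α - ρ α))) = Valued.v ϖE ^ a := by rw [hP.2, v_pow_eq_exp_neg hϖE]
      refine (dep_top_iff (Θ := Θ) (α := α) hρρ hvρ hρϖE hϖE hh hm hjl ham hma x₀.ne_zero ((map_ne_zero Θ).2 x₀.ne_zero) hya).2 ?_
      rw [htw]; exact hωtop
  rw [hPQ, ncard_image_mk_smul]
  -- the level side in closed form (★ aniso head): `|G_j| = (q+1)q^{j−1}` (`j ≥ 1` here)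
  rw [ncard_levelSet_unr_aniso hρρ hvρ hΘΘ hΘρ hvΘ hα1 hα hρϖE hϖE hΘh hh hq hσ' hvσ' hfix' hπ' hdd' hd jK hjv hjΘ hjfix hjσ hnorm haniso j a,
    if_pos (show (d ≤ j + 1 ∧ a + d = j + 1) ∨ (j + 1 < d ∧ a = 0 ∧ (j + d) % 2 = 1) from Or.inl ⟨by omega, hgood⟩),
    if_neg (show j ≠ 0 by omega)]
  by_cases hχ : ∃ ω₁ : Kˣ, Valued.v (ω₁ : K) = 1 ∧
      Valued.v (1 + ρ h / h / (ρ μ / μ) * (ρ ((ω₁ : K) * Θ ω₁) / ((ω₁ : K) * Θ ω₁))) ≤ exp (-((j + a : ℕ) - (m : ℤ)))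
  · obtain ⟨ω₁, hω₁, hω₁top⟩ := hχ
    rw [if_pos ((topBit_iff_exists_unit hΘΘ hvΘ hnorm (ρ h / h) hκ _).2 ⟨ω₁, hω₁, hω₁top⟩)]
    -- the passing set is `ω₁ • B_{s₀}`
    obtain ⟨B, hB⟩ := exists_subgroup_normDepth (Θ := Θ) hvρ hvΘ (exp (-((j + a : ℕ) - (m : ℤ))))
    rw [setOf_v_one_add_mul_twist_le_eq_smul_of_le hvρ hvΘ hω₁ hω₁top hB, ncard_image_mk_smul_subgroup H B ω₁]
    -- indices: `[B_{s₀} : H]·[U : B_{s₀}] = [U : H]`, `[U : B_{s₀}] = q^{⌊(s₀+1−d)∕2⌋} = q^{⌊e∕2⌋}`, `[U : H] = (q+1)q^{j−1}`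
    have hs : (-((j + a : ℕ) - (m : ℤ))) = -((j + a - m : ℕ) : ℤ) := by push_cast; omega
    have hB' : ∀ ω, ω ∈ B ↔ Valued.v (ω : K) = 1 ∧ Valued.v ((ω : K) * Θ ω - ρ ((ω : K) * Θ ω)) ≤ exp (-((j + a - m : ℕ) : ℤ)) :=
      fun ω => by rw [hB ω, hs]
    have hBU : B.relIndex U = q ^ ((j + a - m + 1 - d) / 2) :=
      relIndex_normDepth_eq_pow_half hvρ hΘΘ hvΘ hσ' hvσ' hfix' hπ' hdd' hq' jK hjv hjΘ hjfix hjσ hnorm (j + a - m) U B hU hB'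
    have hBle : B ≤ U := fun ω hω => (hU ω).2 ((hB ω).1 hω).1
    have hHB : H ≤ B := orderUnits_le_normDepth hvρ hΘρ hvΘ (by rw [hvc, exp_le_exp]; omega) hH hB
    have hHU : H.relIndex U = (q + 1) * q ^ (j - 1) := by
      have hH' : ∀ u, u ∈ H ↔ Valued.v (u : K) = 1 ∧ Valued.v ((u : K) - ρ u) ≤ Valued.v (ϖE ^ j) := fun u => by
        rw [hH u, map_mul Valued.v (ϖE ^ j), hα, mul_one]
      exact relIndex_orderUnits_eq_of_unramified hρρ hvρ hα1 hα hϖE hq (by omega) U H hU hH'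
    have hmul := Subgroup.relIndex_mul_relIndex H B U hHB hBle
    have hE : (j + a - m + 1 - d) / 2 = (2 * a - m) / 2 := by omega
    rw [hBU, hHU, hE] at hmul
    rw [mul_comm]
    exact hmul
  · rw [if_neg (fun h1 => hχ ((topBit_iff_exists_unit hΘΘ hvΘ hnorm (ρ h / h) hκ _).1 h1))]
    have hempty : {ω : Kˣ | Valued.v (ω : K) = 1 ∧
        Valued.v (1 + ρ h / h / (ρ μ / μ) * (ρ ((ω : K) * Θ ω) / ((ω : K) * Θ ω))) ≤ exp (-((j + a : ℕ) - (m : ℤ)))} = ∅ :=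
      Set.eq_empty_of_forall_notMem (fun ω hω => hχ ⟨ω, hω.1, hω.2⟩)
    rw [hempty, Set.image_empty, Set.ncard_empty, mul_zero]

end Summit.HodgeConjecture.HodgeConjecture.Cruxes.H413.F0P3cDyRamToricLevelCensusUnr
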